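import Summits.HodgeConjecture.HodgeConjecture.Theorems.F0P6bWDockSeams   -- ★ previous part of the same Lines workfile (size-lint split; same namespace `Summit.HodgeConjecture.HodgeConjecture.Cruxes.HLiu418.F0P6bWDock`)
import HarnessLib

/-!
# `F0P6bWDock` — ★ RE-HOME of `Lines/F0_P6b_WDock.lean` (tree ED. 4 7d61e77295a90030), PART 4 of 4 — §6.8 (ED. 4, organ (iv)) `WBlockLawLA3` (the shifted kernel՚s rank); this is the module the `Lines/` shim and W-consumers import (it transitively carries parts 1–3).

See PART 1 `Theorems/F0P6bWDockPackage.lean` for the full re-home header and the original module docstring (verbatim there). Namespace KEPT: `Summit.HodgeConjecture.HodgeConjecture.Cruxes.HLiu418.F0P6bWDock`;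
code bytes = the workfile՚s, docstrings included; preamble (options ∕ `noncomputable section` ∕ `universe u` ∕ `open`s) repeated verbatim from PART 1.
HC_CM is proved only modulo the 7 printed citations (2 remaining: hLiu418 = stmt-HodgeConjecture-24832, h413 = stmt-HodgeConjecture-24833) until rung 0 closes; a re-home is count-neutral. -/

set_option autoImplicit false
set_option linter.dupNamespace false

-- Mathlib's `Over`/`Scheme` APIs are stated across semireducible wrappers (as in the two P6b Lines modules imported here).
set_option backward.isDefEq.respectTransparency false

noncomputable section

universe u

open CategoryTheory CategoryTheory.Limits AlgebraicGeometry MonoidalCategory CartesianMonoidalCategory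
open scoped MonObj
open Literature.AlgebraicGeometry.GroupSchemes Literature.AlgebraicGeometry.GroupSchemes.GroupSchemeKernel
open Literature.AlgebraicGeometry.GroupSchemes.AffineGroupScheme Literature.AlgebraicGeometry.GroupSchemes.TorsionLayer
open Literature.AlgebraicGeometry.Motives Literature.AlgebraicGeometry.Motives.AbelianVariety
open Literature.AlgebraicGeometry.AbelianSchemes Literature.AlgebraicGeometry.AbelianSchemes.AbelianSchemeOver
open Literature.AlgebraicGeometry.AbelianSchemes.AbelianSchemeOver.DualPair
open Summit.HodgeConjecture.HodgeConjecture.Cruxes.HLiu418.F0P6bWeilCartierDuality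
open Literature.AlgebraicGeometry.Motives.AbelianVarietyFrobeniusBlockLagrangian   -- (BLF)՚s ★ namespace (was `…Cruxes.HLiu418.F0P6bFrobeniusLagrangian`)

namespace Summit.HodgeConjecture.HodgeConjecture.Cruxes.HLiu418.F0P6bWDock

/-! ## §6.8 (ED. 4, organ (iv)) (I-rk) THE SHIFTED KERNEL'S RANK, REDUCED TO THE ϖ-LAYER COUNT — «L3» LA3-p03 (g3)'s pack VERBATIM

HOME pack of record `F0/P6/L3/LA3-p03/g3/F0P6bWDockShiftedKernelRank.v1.LA3-p03g3.lean` 28b71d69db1efa89 (190 l.; by import on ED. 3, rc 0, `hrk_of_layer_count` TRIO),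
folded ADD-ONLY by the P6b pen (statements, proofs, docstrings and the shared `variable` block byte-identical; only the namespace opener is re-rooted here).
THE ROW.  Package data `j : G = A[q] ↪ A` (`hG`), `β` (`hβj`, `hβmul`), `jW : W = Fix β(ε̄) ↪ G` (`hW`, `hidemW`), `q = p^r`, shift `s := p^{r−1}`; consumer's objects
`jV : V = W[p] ↪ W`, `νN : N = Ker q̄ ∩ W[p] ↪ V`, the SHIFTED KERNEL `ψ : Ψ ↪ W` (ED4c's `hΨ` verbatim) and the shift `φ : W → V` (`exists_shiftHom`).  `φ = [p^{r−1}]|_W` is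
fppf-LIFTABLE (`liftable_shiftHom`: an `s`-th root in `A` is `q`-torsion, its `β(ε̄)`-projection is a lift in `W`; ★ `liftable_of_cover` over ★ `[s] : A ↠ A`), `Ψ = φ⁻¹(N)`,
so ★ `finrank_alg_preimage_mul_eq_of_liftable` gives `rk Γ(Ψ) · rk Γ(W[p]) = rk Γ(W) · rk Γ(N)` (`finrank_shiftedKernel_mul_finrank_layer`) and ED4c's `hrk` follows from the ONE
numeric row `hcount : rk Γ(W[p]) = rk Γ(N) · rk Γ(𝒦)` (`hrk_of_layer_count`; (γ) `rk W[p] = q²`, (k2b) `rk (Ker q̄ ∩ W[p]) = q`, (k1) `rk 𝒦 = q`). -/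

namespace WBlockLawLA3

-- LA3-p03's sectioning: ONE shared `variable` block whose instance binders are package-wide (option scoped to this namespace).
set_option linter.unusedSectionVars false

variable {k : Type u} [Field k] (p r : ℕ) (A : AbelianSchemeOver (Spec (.of k))) {O : Type} [CommRing O] (star : O →+* O)
  (act : A.RingAction O) (εu : O)
  -- the torsion layer `G = A[q]`, its pin, the layer action (package data and laws; only what each statement needs)
  (G : SchemeOver k) [GrpObj G] [IsCommMonObj G] (j : G ⟶ A.X) [IsMonHom j] [Mono j] (β : O → (G ⟶ G)) [∀ a, IsMonHom (β a)]
  (hG : ∀ ⦃T : SchemeOver k⦄ (t : T ⟶ A.X), (∃ s : T ⟶ G, s ≫ j = t) ↔ t ≫ ((((p ^ r : ℕ) : ℤ) • 𝟙 A.toAffine.toAbelianVariety).hom.hom.hom) = 1)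
  (hβj : ∀ a, β a ≫ j = j ≫ act.i a) (hβ1 : β 1 = 𝟙 G) (hβadd : ∀ a b, β (a + b) = β a * β b) (hβmul : ∀ a b, β (a * b) = β b ≫ β a)
  (hq : (𝟙 G) ^ (p ^ r) = 1) (hidemW : β (star εu) ≫ β (star εu) = β (star εu))
  -- the `w`-layer `W = Fix β(ε̄)`
  (W : SchemeOver k) [GrpObj W] [IsAffine W.left] (jW : W ⟶ G) [IsMonHom jW] [Mono jW]
  (hW : ∀ ⦃T : SchemeOver k⦄ (x : T ⟶ G), (∃ s : T ⟶ W, s ≫ jW = x) ↔ x ≫ β (star εu) = x)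
  -- the ϖ-layer `V = W[p]` (consumer's object)
  (V : SchemeOver k) [GrpObj V] [IsAffine V.left] (jV : V ⟶ W) [IsMonHom jV] [Mono jV]
  (hV : ∀ ⦃T : SchemeOver k⦄ (x : T ⟶ W), (∃ s : T ⟶ V, s ≫ jV = x) ↔ (x ≫ jW) ≫ β (p : O) = 1)

/-! ## §1 The shift `φ = [p^{r−1}]|_W : W → W[p]` -/

include hβmul hq hβ1 hβadd hW hV in
/-- **THE SHIFT EXISTS**: for `1 ≤ r` there is `φ : W → W[p]` with `φ ≫ jV ≫ jW = jW ≫ β(p^{r−1})` — `W` is `β`-stable (`β(s)` commutes with the idempotent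
`β(ε̄)`, `O` commutative) and `β(p) ∘ β(p^{r−1}) = β(q) = [q] = 1` on `G`. [cite: MumfordAV1970, §19 Thm. 4 (p. 180)] -/
theorem exists_shiftHom (hr : 1 ≤ r) :
    ∃ φ : W ⟶ V, (φ ≫ jV) ≫ jW = jW ≫ β ((p ^ (r - 1) : ℕ) : O) := by
  -- `jW ≫ β s` lands in `W`
  have hfix : jW ≫ β (star εu) = jW := (hW jW).mp ⟨𝟙 W, Category.id_comp jW⟩
  have hcomm : β ((p ^ (r - 1) : ℕ) : O) ≫ β (star εu) = β (star εu) ≫ β ((p ^ (r - 1) : ℕ) : O) := by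
    rw [← hβmul, mul_comm, hβmul]
  obtain ⟨y, hy⟩ := (hW (jW ≫ β ((p ^ (r - 1) : ℕ) : O))).mpr (by rw [Category.assoc, hcomm, ← Category.assoc, hfix])
  -- and is killed by `β p`
  have hkill : (y ≫ jW) ≫ β (p : O) = 1 := by
    rw [hy, Category.assoc, ← hβmul, ← Nat.cast_mul, show p * p ^ (r - 1) = p ^ r from by rw [← _root_.pow_succ', Nat.sub_add_cancel hr],
      WBlockLaw.layerEnd_natCast G β hβ1 hβadd, hq, MonObj.comp_one]
  obtain ⟨φ, hφ⟩ := (hV y).mpr hkill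
  exact ⟨φ, by rw [hφ, hy]⟩

variable (φ : W ⟶ V) (hφ : (φ ≫ jV) ≫ jW = jW ≫ β ((p ^ (r - 1) : ℕ) : O))

include hφ in
/-- The shift is a homomorphism (`φ ≫ jV ≫ jW = jW ≫ β s` is one; `jV ≫ jW` is a monomorphism). [cite: MumfordAV1970, §19 Thm. 4 (p. 180)] -/
theorem isMonHom_shiftHom : IsMonHom φ := by
  haveI : IsMonHom (φ ≫ (jV ≫ jW)) := by rw [← Category.assoc, hφ]; infer_instance
  exact isMonHom_of_comp_mono φ (jV ≫ jW)

/-! ## §2 The shift is fppf-liftable (the `β(ε̄)`-projection of an `s`-th root in `A`) -/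

include hG hβj hβmul hidemW hW hV hφ in
/-- **`φ = [p^{r−1}]|_W : W → W[p]` IS fppf-LIFTABLE**: given a `T`-point `d` of `W[p]`, take an `s`-th root `y` of its image in `A` on an fppf cover (★
`[s] : A ↠ A` flat surjective, `s = p^{r−1} ≠ 0`); `y` is `q`-torsion (`q·y = p·(s·y) = p·d = 1`), so `y ∈ G`, and its projection `β(ε̄)y ∈ W` is a lift:
`s·β(ε̄)y = β(ε̄)(s·y) = β(ε̄) d = d`.  (★ `liftable_of_cover`.) [cite: MumfordAV1970, §12 Thm. 1 (p. 112); §19 Thm. 4 (p. 180)] [cite: GortzWedhorn2020, (14.20)] -/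
theorem liftable_shiftHom (hp : p ≠ 0) (hr : 1 ≤ r) ⦃T : SchemeOver k⦄ (d : T ⟶ V) :
    ∃ (T' : SchemeOver k) (t : T' ⟶ T) (_ : Epi t.left) (x : T' ⟶ W), x ≫ φ = t ≫ d := by
  have hs : p ^ (r - 1) ≠ 0 := pow_ne_zero _ hp
  have hpow : p ^ (r - 1) * p = p ^ r := by rw [← _root_.pow_succ, Nat.sub_add_cancel hr]
  haveI : Flat (A.mulN (p ^ (r - 1))).left := by rw [mulN_def]; exact A.flat_pow_id_left_of_ne_zero hs
  haveI : Surjective (A.mulN (p ^ (r - 1))).left := by rw [mulN_def]; exact A.surjective_pow_id_left_of_ne_zero hs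
  refine liftable_of_cover φ (A.mulN (p ^ (r - 1))) (jV ≫ jW ≫ j) (fun T y d hy => ?_) d
  -- `ι(n) = [n]` on `A`, read through `β` on `G`; `[a·b] = [a] ≫ [b]`
  have hι : ∀ n : ℕ, j ≫ A.mulN n = β (n : O) ≫ j := fun n => by rw [hβj, RingAction.i_natCast, mulN_def]
  have hmul : A.mulN (p ^ (r - 1) * p) = A.mulN (p ^ (r - 1)) ≫ A.mulN p := by
    rw [mulN_def, mulN_def, mulN_def, pow_mul, MonObj.comp_pow, Category.comp_id]
  have hcomm : β (star εu) ≫ β ((p ^ (r - 1) : ℕ) : O) = β ((p ^ (r - 1) : ℕ) : O) ≫ β (star εu) := by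
    rw [← hβmul, mul_comm, hβmul]
  -- the point `d` of `W[p]`, read in `G`: killed by `β p`, fixed by `β(ε̄)`
  have hdp : ((d ≫ jV) ≫ jW) ≫ β (p : O) = 1 := (hV (d ≫ jV)).mp ⟨d, rfl⟩
  have hdfix : ((d ≫ jV) ≫ jW) ≫ β (star εu) = (d ≫ jV) ≫ jW := (hW ((d ≫ jV) ≫ jW)).mp ⟨d ≫ jV, rfl⟩
  -- `y` is `q`-torsion, hence a point `s₀` of `G`
  have hyq' : y ≫ A.mulN (p ^ r) = 1 := by
    rw [← hpow, hmul, ← Category.assoc, hy]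
    calc (d ≫ jV ≫ jW ≫ j) ≫ A.mulN p = ((d ≫ jV) ≫ jW) ≫ (j ≫ A.mulN p) := by simp only [Category.assoc]
      _ = (((d ≫ jV) ≫ jW) ≫ β (p : O)) ≫ j := by rw [hι p]; simp only [Category.assoc]
      _ = 1 := by rw [hdp, MonObj.one_comp]
  have hyq : y ≫ ((((p ^ r : ℕ) : ℤ) • 𝟙 A.toAffine.toAbelianVariety).hom.hom.hom) = 1 := by
    rw [← mulN_eq_zsmul_id A (p ^ r)]
    exact hyq'
  obtain ⟨s₀, hs₀⟩ := (hG y).mpr hyq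
  -- its `β(ε̄)`-projection is a point `x` of `W`
  obtain ⟨x, hx⟩ := (hW (s₀ ≫ β (star εu))).mpr (by rw [Category.assoc, hidemW])
  refine ⟨x, ?_⟩
  -- `s·s₀ = d` in `G` (compare after `j`: both are `y ≫ [s]`)
  have key : s₀ ≫ β ((p ^ (r - 1) : ℕ) : O) = (d ≫ jV) ≫ jW := by
    rw [← cancel_mono j, Category.assoc, ← hι, ← Category.assoc, hs₀, hy]
    simp only [Category.assoc]
  haveI : Mono (jV ≫ jW) := mono_comp _ _
  rw [← cancel_mono (jV ≫ jW)]
  calc (x ≫ φ) ≫ jV ≫ jW = x ≫ (φ ≫ jV) ≫ jW := by simp only [Category.assoc]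
    _ = x ≫ jW ≫ β ((p ^ (r - 1) : ℕ) : O) := by rw [hφ]
    _ = (s₀ ≫ β (star εu)) ≫ β ((p ^ (r - 1) : ℕ) : O) := by rw [← Category.assoc, hx]
    _ = (s₀ ≫ β ((p ^ (r - 1) : ℕ) : O)) ≫ β (star εu) := by rw [Category.assoc, Category.assoc, hcomm]
    _ = ((d ≫ jV) ≫ jW) ≫ β (star εu) := by rw [key]
    _ = d ≫ jV ≫ jW := by rw [hdfix, Category.assoc]

/-! ## §3 The shifted kernel is the preimage of `N = Ker q̄ ∩ W[p]`; its rank -/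

variable (N : SchemeOver k) [GrpObj N] [IsAffine N.left] (νN : N ⟶ V) [IsMonHom νN] [Mono νN]
  {B : AbelianSchemeOver (Spec (.of k))} (qbar : A.X ⟶ B.X)
  (hN : ∀ ⦃T : SchemeOver k⦄ (d : T ⟶ V), (∃ e : T ⟶ N, e ≫ νN = d) ↔ (((d ≫ jV) ≫ jW) ≫ j) ≫ qbar = 1)
  (Ψ : SchemeOver k) [GrpObj Ψ] [IsAffine Ψ.left] (ψ : Ψ ⟶ W) [IsMonHom ψ] [Mono ψ]
  (hΨ : ∀ ⦃T : SchemeOver k⦄ (x : T ⟶ W), (∃ c : T ⟶ Ψ, c ≫ ψ = x) ↔ (((x ≫ jW) ≫ β ((p ^ (r - 1) : ℕ) : O)) ≫ j) ≫ qbar = 1)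

include hφ hN hΨ in
/-- ED4c's points law `hΨ` («`x ≫ jW ≫ β s ≫ j ≫ q̄ = 1`») IS the preimage law «`x ≫ φ` factors through `N = Ker q̄ ∩ W[p]`» (★ `PreimageRankOfLiftable`'s `hΨ`).
[cite: GortzWedhorn2020, Def. 4.45 (2) (p. 117)] -/
theorem preimage_points_iff ⦃T : SchemeOver k⦄ (x : T ⟶ W) : (∃ c : T ⟶ Ψ, c ≫ ψ = x) ↔ ∃ d : T ⟶ N, d ≫ νN = x ≫ φ := by
  have hφ' : φ ≫ jV ≫ jW = jW ≫ β ((p ^ (r - 1) : ℕ) : O) := by rw [← Category.assoc]; exact hφ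
  have hx : ((x ≫ φ) ≫ jV) ≫ jW = (x ≫ jW) ≫ β ((p ^ (r - 1) : ℕ) : O) := by
    rw [Category.assoc, Category.assoc, hφ', ← Category.assoc]
  rw [hΨ x, hN (x ≫ φ), hx]

include hG hβj hβmul hidemW hW hV hφ hN hΨ in
/-- **`rk Γ(Ψ) · rk Γ(W[p]) = rk Γ(W) · rk Γ(Ker q̄ ∩ W[p])`** — the shifted kernel is the preimage of `N` under the liftable shift `φ = [p^{r−1}]|_W`
(★ `finrank_alg_preimage_mul_eq_of_liftable`; `p ≠ 0`, `1 ≤ r`). [cite: Tate1997FiniteFlatGroupSchemes, §(3.7)–(3.8) (pp. 144–146)] [cite: Waterhouse1979, §14.1 Theorem] -/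
theorem finrank_shiftedKernel_mul_finrank_layer [Module.Finite k (Alg W)] [Module.Finite k (Alg Ψ)] (hp : p ≠ 0) (hr : 1 ≤ r) :
    Module.finrank k (Alg Ψ) * Module.finrank k (Alg V) = Module.finrank k (Alg W) * Module.finrank k (Alg N) := by
  haveI := isMonHom_shiftHom p r G β W jW V jV φ hφ
  have hpre := preimage_points_iff p r A G j β W jW V jV φ hφ N νN qbar hN Ψ ψ hΨ
  obtain ⟨φ', hφ'⟩ := exists_restrict_of_preimage φ νN ψ hpre
  exact finrank_alg_preimage_mul_eq_of_liftable φ νN ψ hpre φ' hφ'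
    (liftable_shiftHom p r A star act εu G j β hG hβj hβmul hidemW W jW hW V jV hV φ hφ hp hr)

include hG hβj hβmul hidemW hW hV hφ hN hΨ in
/-- **ED4c's `hrk` FROM ONE NUMERIC ROW**: if `rk Γ(W[p]) = rk Γ(Ker q̄ ∩ W[p]) · rk Γ(𝒦)` (the ϖ-layer count `q² = q · q`) then
`rk Γ(W) = rk Γ(Ψ) · rk Γ(𝒦)` — the `hrk` binder of `WBlockLawED4c.hKW_of_isotropy_of_finrank`. [cite: Tate1997FiniteFlatGroupSchemes, §(3.8) p. 146] [cite: Liu2021, Prop. D.8 (3) pp. 136–138] -/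
theorem hrk_of_layer_count [Module.Finite k (Alg W)] [Module.Finite k (Alg Ψ)] (hp : p ≠ 0) (hr : 1 ≤ r) (𝒦 : SchemeOver k)
    (hcount : Module.finrank k (Alg V) = Module.finrank k (Alg N) * Module.finrank k (Alg 𝒦)) (hN0 : 0 < Module.finrank k (Alg N)) :
    Module.finrank k (Alg W) = Module.finrank k (Alg Ψ) * Module.finrank k (Alg 𝒦) := by
  have h := finrank_shiftedKernel_mul_finrank_layer p r A star act εu G j β hG hβj hβmul hidemW W jW hW V jV hV φ hφ N νN qbar hN Ψ ψ hΨ hp hr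
  rw [hcount] at h
  have h' : (Module.finrank k (Alg Ψ) * Module.finrank k (Alg 𝒦)) * Module.finrank k (Alg N) =
      Module.finrank k (Alg W) * Module.finrank k (Alg N) := by rw [← h]; ring
  exact (Nat.eq_of_mul_eq_mul_right hN0 h').symm

/-! ## §4 (v2) The (γ) seam: `V = W[p]` IS the `𝔭_{w′}`-torsion layer `A[𝔭_{w′}]` (same `T`-points ⇒ isomorphic ⇒ same rank) -/

variable (w' 𝔟' : Ideal O) (hpw' : Ideal.span {(p : O)} = w' * 𝔟') (hε1 : star εu - 1 ∈ w') (hε0 : star εu ∈ 𝔟')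

include hG hβj hβmul hW hV hpw' hε1 hε0 in
/-- **THE `T`-POINTS OF `V = W[p]` IN `A` ARE THE `𝔭_{w′}`-TORSION POINTS**: for the place `w′` cut out by `ε̄ = star εu` (`ε̄ − 1 ∈ 𝔭_{w′}`, `ε̄ ∈ 𝔟′`,
`(p) = 𝔭_{w′}·𝔟′` — unramified), a `T`-point `t` of `A` factors through `V ↪ W ↪ G ↪ A` iff `ι(c) t = 1` for every `c ∈ 𝔭_{w′}`.  (⇒: `c·ε̄ ∈ 𝔭_{w′}𝔟′ = (p)`
and `p` kills `V`; ⇐: `p ∈ 𝔭_{w′}` makes `t` `q`-torsion (`1 ≤ r`), `ε̄ ≡ 1 (𝔭_{w′})` fixes it, `p` kills it.) [cite: Tate1997FiniteFlatGroupSchemes, (3.7)]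
[cite: Liu2021, Prop. D.8 (3) pp. 136–138] -/
theorem layer_points_iff [IsCommMonObj A.X] (hr : 1 ≤ r) ⦃T : SchemeOver k⦄ (t : T ⟶ A.X) :
    (∃ x : T ⟶ V, ((x ≫ jV) ≫ jW) ≫ j = t) ↔ ∀ c ∈ w', t ≫ act.i c = 1 := by
  constructor
  · rintro ⟨x, rfl⟩ c hc
    -- `c · ε̄ = p · d`
    have hmem : c * star εu ∈ Ideal.span {(p : O)} := by rw [hpw']; exact Ideal.mul_mem_mul hc hε0
    obtain ⟨d, hd⟩ := Ideal.mem_span_singleton'.mp hmem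
    have hfix : ((x ≫ jV) ≫ jW) ≫ β (star εu) = (x ≫ jV) ≫ jW := (hW ((x ≫ jV) ≫ jW)).mp ⟨x ≫ jV, rfl⟩
    have hkill : ((x ≫ jV) ≫ jW) ≫ β (p : O) = 1 := (hV (x ≫ jV)).mp ⟨x, rfl⟩
    calc (((x ≫ jV) ≫ jW) ≫ j) ≫ act.i c = (((x ≫ jV) ≫ jW) ≫ β (star εu)) ≫ β c ≫ j := by rw [hfix, Category.assoc, hβj]
      _ = ((x ≫ jV) ≫ jW) ≫ β (c * star εu) ≫ j := by rw [hβmul]; simp only [Category.assoc]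
      _ = ((x ≫ jV) ≫ jW) ≫ (β (p : O) ≫ β d) ≫ j := by rw [← hd, hβmul]
      _ = ((((x ≫ jV) ≫ jW) ≫ β (p : O)) ≫ β d) ≫ j := by simp only [Category.assoc]
      _ = 1 := by rw [hkill, MonObj.one_comp, MonObj.one_comp]
  · intro h
    -- `p ∈ 𝔭_{w′}`, so `t` is `p`-torsion, hence `q`-torsion: a point `s` of `G`
    have hp' : (p : O) ∈ w' := Ideal.mul_le_right (hpw' ▸ Ideal.mem_span_singleton_self (p : O))
    have htp : t ≫ A.mulN p = 1 := by rw [mulN_def, ← RingAction.i_natCast act p]; exact h _ hp'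
    haveI := A.isMonHom_mulN (p ^ (r - 1))
    have htq : t ≫ ((((p ^ r : ℕ) : ℤ) • 𝟙 A.toAffine.toAbelianVariety).hom.hom.hom) = 1 := by
      have hpow : p * p ^ (r - 1) = p ^ r := by rw [← _root_.pow_succ', Nat.sub_add_cancel hr]
      have hmul : A.mulN (p * p ^ (r - 1)) = A.mulN p ≫ A.mulN (p ^ (r - 1)) := by
        rw [mulN_def, mulN_def, mulN_def, pow_mul, MonObj.comp_pow, Category.comp_id]
      rw [← mulN_eq_zsmul_id A (p ^ r), ← hpow, hmul, ← Category.assoc, htp, MonObj.one_comp]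
    obtain ⟨s, hs⟩ := (hG t).mpr htq
    -- `ε̄` fixes `s` (`ε̄ − 1 ∈ 𝔭_{w′}` kills `t`): `s` is a point `x′` of `W`
    have hsfix : s ≫ β (star εu) = s := by
      rw [← cancel_mono j, Category.assoc, hβj, ← Category.assoc, hs,
        show star εu = (star εu - 1) + 1 from (sub_add_cancel _ _).symm, act.comp_i_add, h _ hε1, one_mul, act.i_one, Category.comp_id]
    obtain ⟨x', hx'⟩ := (hW s).mpr hsfix
    -- `p` kills `x′`: `x′` is a point `x` of `V`
    have hx'p : (x' ≫ jW) ≫ β (p : O) = 1 := by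
      rw [← cancel_mono j, Category.assoc, hβj, ← Category.assoc, hx', hs, RingAction.i_natCast, ← mulN_def, htp, MonObj.one_comp]
    obtain ⟨x, hx⟩ := (hV x').mpr hx'p
    exact ⟨x, by rw [hx, hx', hs]⟩

include hG hβj hβmul hW hV hpw' hε1 hε0 in
/-- **`V ≅ A[𝔭_{w′}]`** for ANY realisation `ιw : Gw ↪ A` of the `𝔭_{w′}`-torsion (all-`T` points law; e.g. ★ p849994 `exists_idealTorsionLayer_finrank_eq`):
two subobjects of `A` with the same points (`layer_points_iff`), ★ `exists_iso_of_fac_of_fac`. [cite: GortzWedhorn2020, Def. 4.45 (2) (p. 117)] -/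
theorem nonempty_layer_iso [IsCommMonObj A.X] (hr : 1 ≤ r) (Gw : SchemeOver k) (ιw : Gw ⟶ A.X) [Mono ιw]
    (hGw : ∀ ⦃T : SchemeOver k⦄ (t : T ⟶ A.X), (∀ c ∈ w', t ≫ act.i c = 1) ↔ ∃ s : T ⟶ Gw, s ≫ ιw = t) :
    ∃ e : V ≅ Gw, e.hom ≫ ιw = (jV ≫ jW) ≫ j := by
  haveI : Mono ((jV ≫ jW) ≫ j) := by haveI : Mono (jV ≫ jW) := mono_comp _ _; exact mono_comp _ _
  have hpts := layer_points_iff p r A star act εu G j β hG hβj hβmul W jW hW V jV hV w' 𝔟' hpw' hε1 hε0 hr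
  -- `V → Gw`: the tautological point of `V` is `𝔭_{w′}`-torsion
  obtain ⟨u, hu⟩ := (hGw ((jV ≫ jW) ≫ j)).mp ((hpts _).mp ⟨𝟙 V, by simp only [Category.id_comp, Category.assoc]⟩)
  -- `Gw → V`: the tautological point of `Gw` factors through `V`
  obtain ⟨v, hv⟩ := (hpts ιw).mpr ((hGw ιw).mpr ⟨𝟙 Gw, Category.id_comp ιw⟩)
  obtain ⟨e, he, -⟩ := exists_iso_of_fac_of_fac ((jV ≫ jW) ≫ j) ιw u hu v (by rw [← hv]; simp only [Category.assoc])
  exact ⟨e, he⟩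

include hG hβj hβmul hW hV hpw' hε1 hε0 in
/-- **`rk Γ(V) = rk Γ(A[𝔭_{w′}])`** — hence `= q²` when the realisation is ★ p849994's (`rk Γ = p^f·p^f`): the (γ) input of `hcount`.
[cite: Tate1997FiniteFlatGroupSchemes, (3.7)] [cite: RapoportSmithlingZhang2020Diagonal, §4.1 (p. 17)] -/
theorem finrank_layer_eq [IsCommMonObj A.X] (hr : 1 ≤ r) (Gw : SchemeOver k) (ιw : Gw ⟶ A.X) [Mono ιw]
    (hGw : ∀ ⦃T : SchemeOver k⦄ (t : T ⟶ A.X), (∀ c ∈ w', t ≫ act.i c = 1) ↔ ∃ s : T ⟶ Gw, s ≫ ιw = t) :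
    Module.finrank k (Alg V) = Module.finrank k (Alg Gw) := by
  obtain ⟨e, -⟩ := nonempty_layer_iso p r A star act εu G j β hG hβj hβmul W jW hW V jV hV w' 𝔟' hpw' hε1 hε0 hr Gw ιw hGw
  exact Alg.finrank_eq_of_iso e

end WBlockLawLA3

end Summit.HodgeConjecture.HodgeConjecture.Cruxes.HLiu418.F0P6bWDock

end
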